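import Summits.Ventures.DiscreteObjects.PP12.FanoFiveECode
import Summits.Ventures.DiscreteObjects.PP12.FanoFiveSignSymmetry

/-!
# PP(12), order 5: symmetries and a NORMAL FORM of the coding statement (kernel; the search domain of the engines, and of a future kernel certificate)
Framing: lottery ticket; floor = certified bounds/negative ranges.

Cell pub-namedobj (venture DiscreteObjects), target (M), designs gen 17. `FanoFive.IsECode` (`FanoFiveECode`) is invariant under column sign flips
(translations of the binary code), column permutations (`S₇`) and row permutations (`S₁₆`): `IsECode.transform`. Every E-code has a transform in
NORMAL FORM `IsNormalized` — row `0` all `+1`, row `1` equal to `−1` except `+1` at coordinate `5`, row `2` equal to `−1` except `+1` at coordinate `6`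
(the two rows at inner product `−5` from row `0`, their exceptional coordinates moved to `5, 6`): `IsECode.exists_normalized`. Hence
**`noECode_of_noECodeNF : NoECodeNF → NoECode`** — it suffices to refute normalized codes. This is exactly the normalization of designs g17's engine
`ecode2.c` (`v₀ = 0`, weight-6 words `W5, W6`) and, up to the coordinate pair `(0,1) ↔ (5,6)`, of designs g10's `codeB.c`; it is also the entry point of a
future kernel certificate (HANDOFF: per-class `decide` over the normalized search, ≈ 8·10⁷ DFS nodes in total, ≈ 10⁵ per class of weight-2 rows).
Nothing here asserts any census statement. No `sorry`, no new axioms.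
-/

namespace Summit.Ventures.DiscreteObjects.PP12

open Finset

namespace FanoFive

/-- normal form: row `0` is `+1`, rows `1, 2` are `−1` except at the coordinates `5`, `6` respectively -/
def IsNormalized (E : Fin 16 → Fin 7 → ℤ) : Prop :=
  (∀ x, E 0 x = 1) ∧ (∀ x, E 1 x = if x = 5 then 1 else -1) ∧ (∀ x, E 2 x = if x = 6 then 1 else -1)

/-- **census statement in normal form** -/
def NoECodeNF : Prop := ∀ E : Fin 16 → Fin 7 → ℤ, IsNormalized E → ¬ IsECode E

/-- the product of a sign vector is `(−1)^{wt}` -/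
theorem prod_sign_eq {v : Fin 7 → ℤ} (hv : ∀ x, v x = 1 ∨ v x = -1) :
    ∏ x, v x = (-1) ^ (univ.filter fun x => v x = -1).card := by
  have e : ∀ x, v x = if v x = -1 then (-1 : ℤ) else 1 := fun x => by rcases hv x with h | h <;> simp [h]
  conv_lhs => rw [show (fun x => v x) = fun x => if v x = -1 then (-1 : ℤ) else 1 from funext e]
  rw [Finset.prod_ite, Finset.prod_const, Finset.prod_const_one, mul_one]

/-- parities of two naturals agree iff the corresponding powers of `−1` agree -/
theorem neg_one_pow_eq_iff_mod (a b : ℕ) : ((-1 : ℤ) ^ a = (-1) ^ b) ↔ (a : ℤ) % 2 = (b : ℤ) % 2 := by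
  rw [neg_one_pow_eq_pow_mod_two (R := ℤ) (n := a), neg_one_pow_eq_pow_mod_two (R := ℤ) (n := b)]
  have ha := Nat.mod_two_eq_zero_or_one a
  have hb := Nat.mod_two_eq_zero_or_one b
  rcases ha with ha | ha <;> rcases hb with hb | hb <;> simp [ha, hb] <;> omega

namespace IsECode

variable {E : Fin 16 → Fin 7 → ℤ}

/-- the inner product of a row with itself is `7` -/
theorem inner_self (h : IsECode E) (O : Fin 16) : ∑ x, E O x * E O x = 7 := by
  have : ∀ x, E O x * E O x = 1 := fun x => by rcases h.sign O x with h1 | h1 <;> rw [h1] <;> norm_num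
  simp_rw [this]; simp

/-- **the symmetries of the coding statement**: column signs `t`, column permutation `π`, row permutation `α` -/
theorem transform (h : IsECode E) (t : Fin 7 → ℤ) (ht : ∀ x, t x = 1 ∨ t x = -1) (π : Equiv.Perm (Fin 7)) (α : Equiv.Perm (Fin 16)) :
    IsECode fun O x => t x * E (α O) (π x) := by
  have tsq : ∀ x, t x * t x = 1 := fun x => by rcases ht x with h1 | h1 <;> rw [h1] <;> norm_num
  -- inner products of rows are transported
  have inner : ∀ O X, ∑ x, t x * E (α O) (π x) * (t x * E (α X) (π x)) = ∑ y, E (α O) y * E (α X) y := by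
    intro O X
    rw [← Equiv.sum_comp π (fun y => E (α O) y * E (α X) y)]
    exact Finset.sum_congr rfl fun x _ => by rw [show t x * E (α O) (π x) * (t x * E (α X) (π x)) =
      (t x * t x) * (E (α O) (π x) * E (α X) (π x)) by ring, tsq, one_mul]
  have cardv : ∀ (O : Fin 16) (v : ℤ), (univ.filter fun X => ∑ x, t x * E (α O) (π x) * (t x * E (α X) (π x)) = v).card =
      (univ.filter fun Y => ∑ y, E (α O) y * E Y y = v).card := by
    intro O v
    simp_rw [inner]
    exact card_filter_perm α (fun Y => ∑ y, E (α O) y * E Y y = v)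
  refine ⟨fun O x => ?_, fun x => ?_, fun O O' hne heq => ?_, fun O O' => ?_, fun O => ?_, fun O => ?_, fun O => ?_, fun x y hxy => ?_⟩
  · rcases ht x with h1 | h1 <;> rcases h.sign (α O) (π x) with h2 | h2 <;> simp [h1, h2]
  · rw [← Finset.mul_sum, Equiv.sum_comp α (fun O => E O (π x)), h.balanced (π x), mul_zero]
  · refine h.rows_ne (α O) (α O') (α.injective.ne hne) (funext fun y => ?_)
    have e : t (π.symm y) * E (α O) (π (π.symm y)) = t (π.symm y) * E (α O') (π (π.symm y)) := congrFun heq (π.symm y)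
    rw [Equiv.apply_symm_apply] at e
    rcases ht (π.symm y) with h1 | h1 <;> rw [h1] at e <;> linarith
  · -- parity via products
    have hp := h.parity (α O) (α O')
    have signs : ∀ Z, ∀ x, t x * E (α Z) (π x) = 1 ∨ t x * E (α Z) (π x) = -1 := fun Z x => by
      rcases ht x with h1 | h1 <;> rcases h.sign (α Z) (π x) with h2 | h2 <;> simp [h1, h2]
    have prodT : ∀ Z, ∏ x, t x * E (α Z) (π x) = (∏ x, t x) * ∏ y, E (α Z) y := fun Z => by
      rw [Finset.prod_mul_distrib, Equiv.prod_comp π (fun y => E (α Z) y)]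
    have pO := prod_sign_eq (signs O)
    have pO' := prod_sign_eq (signs O')
    rw [prodT] at pO pO'
    rw [prod_sign_eq (h.sign (α O))] at pO
    rw [prod_sign_eq (h.sign (α O'))] at pO'
    have hq : (-1 : ℤ) ^ wt E (α O) = (-1) ^ wt E (α O') := (neg_one_pow_eq_iff_mod _ _).2 hp
    unfold wt at hq ⊢
    apply (neg_one_pow_eq_iff_mod _ _).1
    rw [← pO, ← pO', hq]
  · rw [cardv O (-5)]; exact h.six (α O)
  · rw [cardv O (-1)]; exact h.four (α O)
  · rw [cardv O 3]; exact h.two (α O)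
  · have e : ∑ O, t x * E (α O) (π x) * (t y * E (α O) (π y)) = (t x * t y) * ∑ O', E O' (π x) * E O' (π y) := by
      rw [Finset.mul_sum, ← Equiv.sum_comp α (fun O' => t x * t y * (E O' (π x) * E O' (π y)))]
      exact Finset.sum_congr rfl fun O _ => by ring
    rw [e]
    have hc := h.corr (π x) (π y) (π.injective.ne hxy)
    rcases ht x with h1 | h1 <;> rcases ht y with h2 | h2 <;> rcases hc with h3 | h3 | h3 <;> simp [h1, h2, h3]

/-- a row at inner product `−5` from an all-`+1` row has exactly one `+1` -/
theorem eq_ite_of_inner_neg_five (h : IsECode E) {O : Fin 16} (F : Fin 7 → ℤ) (hF : ∀ x, F x = E 0 x * E O x)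
    (h5 : ∑ x, E 0 x * E O x = -5) : ∃ a, ∀ x, F x = if x = a then 1 else -1 := by
  have hs : ∀ x, F x = 1 ∨ F x = -1 := fun x => by
    rcases h.sign 0 x with h1 | h1 <;> rcases h.sign O x with h2 | h2 <;> simp [hF, h1, h2]
  have e : ∀ x, F x = 2 * (if F x = 1 then (1 : ℤ) else 0) - 1 := fun x => by rcases hs x with h1 | h1 <;> simp [h1]
  have hsum : ∑ x, F x = -5 := by rw [← h5]; exact Finset.sum_congr rfl fun x _ => hF x
  rw [Finset.sum_congr rfl fun x _ => e x, Finset.sum_sub_distrib, ← Finset.mul_sum, Finset.sum_boole] at hsum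
  rw [Finset.sum_const, card_univ, Fintype.card_fin, nsmul_eq_mul, mul_one] at hsum
  have hc : (univ.filter fun x => F x = 1).card = 1 := by push_cast at hsum; omega
  obtain ⟨a, ha⟩ := Finset.card_eq_one.1 hc
  refine ⟨a, fun x => ?_⟩
  have hx : F x = 1 ↔ x = a := by
    have : x ∈ (univ.filter fun y => F y = 1) ↔ x ∈ ({a} : Finset (Fin 7)) := by rw [ha]
    simpa using this
  by_cases hxa : x = a
  · rw [if_pos hxa]; exact hx.2 hxa
  · rw [if_neg hxa]; rcases hs x with h1 | h1
    · exact absurd (hx.1 h1) hxa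
    · exact h1

/-- a permutation of `Fin n` with two prescribed values -/
theorem exists_perm_two {n : ℕ} {a b p q : Fin n} (hab : a ≠ b) (hpq : p ≠ q) : ∃ π : Equiv.Perm (Fin n), π p = a ∧ π q = b := by
  -- σ sends a ↦ p, then τ sends σ b ↦ q fixing p
  let σ : Equiv.Perm (Fin n) := Equiv.swap a p
  have hσa : σ a = p := Equiv.swap_apply_left a p
  have hσb : σ b ≠ p := by
    intro e; rw [← hσa] at e; exact hab (σ.injective e).symm
  let τ : Equiv.Perm (Fin n) := Equiv.swap (σ b) q
  refine ⟨(σ.trans τ).symm, ?_, ?_⟩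
  · rw [Equiv.symm_apply_eq]; simp only [Equiv.trans_apply]
    rw [hσa]; exact (Equiv.swap_apply_of_ne_of_ne hσb.symm hpq).symm
  · rw [Equiv.symm_apply_eq]; simp only [Equiv.trans_apply]
    exact (Equiv.swap_apply_left _ _).symm

/-- a permutation of `Fin 16` fixing `0` with two prescribed values -/
theorem exists_perm_three {O₁ O₂ : Fin 16} (h1 : O₁ ≠ 0) (h2 : O₂ ≠ 0) (h12 : O₁ ≠ O₂) :
    ∃ α : Equiv.Perm (Fin 16), α 0 = 0 ∧ α 1 = O₁ ∧ α 2 = O₂ := by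
  let σ : Equiv.Perm (Fin 16) := Equiv.swap O₁ 1
  have hσ1 : σ O₁ = 1 := Equiv.swap_apply_left O₁ 1
  have hσ0 : σ 0 = 0 := Equiv.swap_apply_of_ne_of_ne h1.symm (by decide)
  have hσ2 : σ O₂ ≠ 1 := by intro e; rw [← hσ1] at e; exact h12 (σ.injective e).symm
  have hσ2' : σ O₂ ≠ 0 := by intro e; rw [← hσ0] at e; exact h2 (σ.injective e)
  let τ : Equiv.Perm (Fin 16) := Equiv.swap (σ O₂) 2
  have hτ0 : τ 0 = 0 := Equiv.swap_apply_of_ne_of_ne hσ2'.symm (by decide)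
  have hτ1 : τ 1 = 1 := Equiv.swap_apply_of_ne_of_ne hσ2.symm (by decide)
  refine ⟨(σ.trans τ).symm, ?_, ?_, ?_⟩
  · rw [Equiv.symm_apply_eq]; simp only [Equiv.trans_apply]; rw [hσ0, hτ0]
  · rw [Equiv.symm_apply_eq]; simp only [Equiv.trans_apply]; rw [hσ1, hτ1]
  · rw [Equiv.symm_apply_eq]; simp only [Equiv.trans_apply]; exact (Equiv.swap_apply_left _ _).symm

/-- **every E-code has a normalized transform** -/
theorem exists_normalized (h : IsECode E) :
    ∃ (t : Fin 7 → ℤ) (π : Equiv.Perm (Fin 7)) (α : Equiv.Perm (Fin 16)),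
      (∀ x, t x = 1 ∨ t x = -1) ∧ IsNormalized fun O x => t x * E (α O) (π x) := by
  -- the two rows at inner product −5 from row 0
  obtain ⟨O₁, O₂, h12, hs⟩ := Finset.card_eq_two.1 (h.six 0)
  have hmem : ∀ X, ∑ x, E 0 x * E X x = -5 ↔ X = O₁ ∨ X = O₂ := fun X => by
    have : X ∈ (univ.filter fun Y => ∑ x, E 0 x * E Y x = -5) ↔ X ∈ ({O₁, O₂} : Finset (Fin 16)) := by rw [hs]
    simpa using this
  have h5₁ : ∑ x, E 0 x * E O₁ x = -5 := (hmem O₁).2 (Or.inl rfl)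
  have h5₂ : ∑ x, E 0 x * E O₂ x = -5 := (hmem O₂).2 (Or.inr rfl)
  have hO₁ : O₁ ≠ 0 := by rintro rfl; rw [h.inner_self 0] at h5₁; norm_num at h5₁
  have hO₂ : O₂ ≠ 0 := by rintro rfl; rw [h.inner_self 0] at h5₂; norm_num at h5₂
  obtain ⟨a, ha⟩ := eq_ite_of_inner_neg_five h (fun x => E 0 x * E O₁ x) (fun _ => rfl) h5₁
  obtain ⟨b, hb⟩ := eq_ite_of_inner_neg_five h (fun x => E 0 x * E O₂ x) (fun _ => rfl) h5₂
  have hab : a ≠ b := by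
    intro e; subst e
    refine h.rows_ne O₁ O₂ h12 (funext fun x => ?_)
    have e1 : E 0 x * E O₁ x = if x = a then 1 else -1 := ha x
    have e2 : E 0 x * E O₂ x = if x = a then 1 else -1 := hb x
    rcases h.sign 0 x with h0 | h0 <;> rw [h0] at e1 e2 <;> linarith
  obtain ⟨π, hπa, hπb⟩ := exists_perm_two (n := 7) hab (show (5 : Fin 7) ≠ 6 by decide)
  obtain ⟨α, hα0, hα1, hα2⟩ := exists_perm_three hO₁ hO₂ h12
  refine ⟨fun x => E 0 (π x), π, α, fun x => h.sign 0 (π x), fun x => ?_, fun x => ?_, fun x => ?_⟩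
  · simp only [hα0]
    rcases h.sign 0 (π x) with h0 | h0 <;> rw [h0] <;> norm_num
  · simp only [hα1]
    have e1 : E 0 (π x) * E O₁ (π x) = if π x = a then 1 else -1 := ha (π x)
    rw [e1]
    have : π x = a ↔ x = 5 := by rw [← hπa]; exact π.injective.eq_iff
    by_cases hx : x = 5
    · rw [if_pos hx, if_pos (this.2 hx)]
    · rw [if_neg hx, if_neg (fun e => hx (this.1 e))]
  · simp only [hα2]
    have e2 : E 0 (π x) * E O₂ (π x) = if π x = b then 1 else -1 := hb (π x)
    rw [e2]
    have : π x = b ↔ x = 6 := by rw [← hπb]; exact π.injective.eq_iff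
    by_cases hx : x = 6
    · rw [if_pos hx, if_pos (this.2 hx)]
    · rw [if_neg hx, if_neg (fun e => hx (this.1 e))]

end IsECode

/-- **it suffices to refute normalized codes** -/
theorem noECode_of_noECodeNF (h0 : NoECodeNF) : NoECode := by
  intro E h
  obtain ⟨t, π, α, ht, hN⟩ := h.exists_normalized
  exact h0 _ hN (h.transform t ht π α)

/-- conversely (trivially) -/
theorem noECodeNF_of_noECode (h0 : NoECode) : NoECodeNF := fun E _ h => h0 E h

end FanoFive

end Summit.Ventures.DiscreteObjects.PP12
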